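import Literature.AnabelianGeometry.SemiGraphs.QuasiTemperoidsThmA4CechLimits
import Literature.AnabelianGeometry.SemiGraphs.QuasiTemperoidsThmA4CechReduction
import Literature.AnabelianGeometry.SemiGraphs.QuasiTemperoidsThmA4Fibre
import HarnessLib

/-!
# Semi-graphs of anabelioids, Appendix: **Theorem A.4 holds** (`thmA4_holds : ThmA4`, F-1634)

Mochizuki, *Semi-graphs of anabelioids*, Publ. RIMS **42** (2006) 221–322, Appendix, Theorem A.4
(manuscript pp. 82–86) [cite: MochizukiSemiAnbd2006, Thm A.4 pp.82-86]: "For `i = 1, 2`, let `T_i` be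
a connected temperoid; let `A_i` be a connected object of `T_i` … Then any morphism of
quasi-temperoids `φ : Q₁ → Q₂` fits into a 1-commutative diagram … where the morphism of temperoids
`ψ : T₁ → T₂` that makes this diagram 1-commute is unique, up to unique isomorphism."

ASSEMBLY (row A4-∃ / file E4 of `plan/L3/SUBDAG-SemiAnbd-Cor311.md`, holder abc-iut-w5-d129) of the
Čech route (abc-iut-w4-d110's construction `ψ^*(X) := coeq(φ^*((X ⨯ A₂) ⨯ A₂) ⇉ φ^*(X ⨯ A₂))`,
cut into files E0–E4 across seats w5-d220 / w4-d048 / w4-d081 / L3-t5 / w5-d129):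

* `ThmA4Cech.cechFiniteLimits` — the last open clause of abc-iut-w5-d220's reduction
  `thmA4_of_cechFiniteLimits` (`QuasiTemperoidsThmA4CechReduction.lean`): for the model
  quasi-temperoids, `ψ^* = ThmA4Cech.Ψ A₂ (φ^* ⋙ ι₁)` PRESERVES FINITE LIMITS — by
  `CechSq.preservesFiniteLimits_cechExt` (`QuasiTemperoidsThmA4CechLimits.lean`; `Ψ = cechExt` on the
  nose) once `φ^* ⋙ ι₁` preserves cospan / binary-product limits (`φ^*` is left exact; `ι₁` preserves
  nonempty-shape limits, `OverPrimeDownwardClosed.lean`) and `φ^*(⊤ ⨯ A₂)` has a point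
  (`ThmA4Chart.map_nonempty`, `QuasiTemperoidsThmA4Fibre.lean`);
* **`thmA4_holds : ThmA4`** — the typed named fact (`QuasiTemperoidsQDPairs.lean`, FACT-LIST F-1634)
  is a THEOREM, with NO Galois-countability hypothesis (the restricted chart-route theorem is
  `thmA4_of_secondCountable`, p416238); uniqueness is abc-iut-w5-d106's `thmA4_unique`.

HONEST FRAMING: this discharges a published prerequisite ([SemiAnbd] is a refereed 2006 paper); it
says nothing about, and takes no side on, [IUTchIII] Cor. 3.12.
-/

open CategoryTheory CategoryTheory.Limits

namespace Literature.AnabelianGeometry.SemiGraphs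

universe v₁ v₂ u u₁ u₂

namespace ThmA4Cech

open Literature.AlgebraicGeometry.Frobenioids (IsConnectedObj)
open Literature.AlgebraicGeometry.Frobenioids.QuasiTemperoid.BTempConnected (nonempty_of_isConnectedObj)

/-- **The Čech extension `ψ^*` of a morphism of model quasi-temperoids preserves finite limits**
(the `hlim` clause of `thmA4_of_cechFiniteLimits`). [cite: MochizukiSemiAnbd2006, Thm A.4 pp.82-86] -/
theorem cechFiniteLimits {G₁ : Type u} [Group G₁] [TopologicalSpace G₁] [IsTopologicalGroup G₁]
    {G₂ : Type u} [Group G₂] [TopologicalSpace G₂] [IsTopologicalGroup G₂]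
    [HasBinaryProducts (BTemp G₂)] [HasColimitsOfShape WalkingParallelPair (BTemp G₁)]
    (_hG₁ : IsTempered G₁) (hG₂ : IsTempered G₂)
    {A₁ : BTemp G₁} (hA₁ : IsConnectedObj A₁) {A₂ : BTemp G₂} (hA₂ : IsConnectedObj A₂)
    (F : Over' A₂ ⥤ Over' A₁) (hFlim : PreservesFiniteLimits F)
    (_hFcolim : ∀ (J : Type) [SmallCategory J] [CountableCategory J], PreservesColimitsOfShape J F)
    (hFnd : ∀ X : Over' A₂, IsNondegenerateObj X → IsNondegenerateObj (F.obj X)) :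
    PreservesFiniteLimits (Ψ A₂ (F ⋙ (admitsHomTo A₁).ι)) := by
  haveI : HasFiniteLimits (BTemp G₂) := BTemp.hasFiniteLimits
  haveI : HasFiniteLimits (BTemp G₁) := BTemp.hasFiniteLimits
  haveI := hFlim
  haveI : PreservesLimitsOfShape WalkingCospan (admitsHomTo A₁).ι :=
    overPrime_ι_preservesLimitsOfShape A₁ WalkingCospan WalkingCospan.one
  haveI : PreservesLimitsOfShape (Discrete WalkingPair) (admitsHomTo A₁).ι :=
    overPrime_ι_preservesLimitsOfShape A₁ (Discrete WalkingPair) ⟨WalkingPair.left⟩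
  haveI : PreservesLimitsOfShape WalkingCospan (F ⋙ (admitsHomTo A₁).ι) := inferInstance
  haveI : PreservesLimitsOfShape (Discrete WalkingPair) (F ⋙ (admitsHomTo A₁).ι) := inferInstance
  -- a point of `φ^*(⊤ ⨯ A₂)`: `⊤ ⨯ A₂` has a point and `φ^*` preserves nonemptiness
  have hne : Nonempty ((F ⋙ (admitsHomTo A₁).ι).obj (CechSq.POver A₂ (⊤_ BTemp G₂))).obj.V := by
    obtain ⟨t⟩ := BTemp.nonempty_of_isTerminal (terminalIsTerminal (C := BTemp G₂))
    obtain ⟨a⟩ := nonempty_of_isConnectedObj A₂ hA₂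
    obtain ⟨p, -, -⟩ := BTemp.exists_point_of_isLimit_binaryFan' (prodIsProd (⊤_ BTemp G₂) A₂) t a
    exact ThmA4Chart.map_nonempty hG₂ hA₁ F hFnd (CechSq.POver A₂ (⊤_ BTemp G₂)) ⟨p⟩
  exact CechSq.preservesFiniteLimits_cechExt A₂ (F ⋙ (admitsHomTo A₁).ι) hne

end ThmA4Cech

/-- **Theorem A.4 of [SemiAnbd] holds** (FACT-LIST F-1634): the typed named fact `ThmA4` is a theorem —
existence by the Čech route (`ThmA4Cech.thmA4_of_cechFiniteLimits` + `cechFiniteLimits`), uniqueness by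
`thmA4_unique`; no Galois-countability hypothesis. [cite: MochizukiSemiAnbd2006, Thm A.4 pp.82-86] -/
theorem thmA4_holds : Literature.AnabelianGeometry.SemiGraphs.ThmA4.{v₁, v₂, u, u₁, u₂} :=
  ThmA4Cech.thmA4_of_cechFiniteLimits (fun hG₁ hG₂ _ hA₁ _ hA₂ F hFlim hFcolim hFnd =>
    ThmA4Cech.cechFiniteLimits hG₁ hG₂ hA₁ hA₂ F hFlim hFcolim hFnd)

end Literature.AnabelianGeometry.SemiGraphs
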